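import Literature.AlgebraicGeometry.HodgeTheory.RibetTypeEightNinePowersHodgeClasses
import Literature.AlgebraicGeometry.HodgeTheory.RibetTypeOfCoreSmulPowersHodgeClasses
import Literature.AlgebraicGeometry.Motives.HodgeThetaSubalgebraUnitarySeventeenCore
import HarnessLib

/-!
# Hodge classes on all powers of abelian varieties of Ribet type `(a, 17)`, every `1 ≤ a ≤ 16`, are generated by divisor
# classes (Ribet 1983 Thm. 3 at these multiplicities — UNCONDITIONAL; 29-FOLDS `{12, 17}`, 31-FOLDS `{14, 17}`)

Family `hodge`, layer `Literature/AlgebraicGeometry/HodgeTheory`. Research context: cell `pub-hodge-ring2` (HONEST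
FRAMING: research route conditional on HC_CM; not a corollary; Q11.4-sentence-2 already refuted in dim ≥ 3),
Literature lane gen 85, programme R71. UNCONDITIONAL for the class of abelian varieties it names; theorems only, no
definition, no named fact (D-0026), no `sorry`. The CELL of the generic assembly `RibetTypeOfCoreSmulPowersHodgeClasses`
at the core `UnitarySeventeen.eq_top_of_smul` (`Motives/HodgeThetaSubalgebraUnitarySeventeenCore`: for the PRIME partner
`17` every rank is coprime to `17`, so the double-Levi route of programme R70 closes `(a | 17)` from a single raising
operator), and the census it refines: the prime-dimension cells `29 = 12 + 17` and `31 = 14 + 17` close.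

THE PRINTED THEOREM. Ribet, Amer. J. Math. 105 (1983), Thm. 3 = Gordon's survey Thm. 6.3 (3) [held
`paper:arxiv-alg-geom_9709030` p. 18].

* §1 `AbelianVariety.isDivisorGenerated_powSucc_of_ribetTypeSeventeen` (and the mirror `'`), the Hodge conjecture for
  these powers; 29-FOLDS of signature `{12, 17}` and 31-FOLDS of signature `{14, 17}`.
* §2 per-`X` census in dimensions `29` and `31`: `B• = D•` on all powers of a simple `29`-fold granted only `End⁰ = ℚ` and
  the `k`-signatures `{8,21}`, `{9,20}`, `{10,19}`, `{14,15}`; of a simple `31`-fold granted only `End⁰ = ℚ` and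
  `{8,23}`, `{9,22}`, `{10,21}`, `{12,19}`, `{15,16}`.

## References
* [Ribet1983] K. A. Ribet, Amer. J. Math. 105 (1983), Thm. 0 and Thm. 3.
* [Gordon1997] B. B. Gordon, *A survey of the Hodge conjecture for abelian varieties*, Thm. 6.3 (3) and Corollary.
* [MoonenZarhin1999LowDim] B. Moonen, Yu. Zarhin, Math. Ann. 315 (1999), §2 (2.4), Thm. (2.7).
* [Deligne2000] P. Deligne, *The Hodge conjecture* (Clay, 2000), §1.
-/

noncomputable section

open CategoryTheory Module

namespace Literature.AlgebraicGeometry.HodgeTheory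

open Literature.AlgebraicGeometry.Motives
open Literature.AlgebraicGeometry.Motives.HodgeStructure

section Cells

/-- **Ribet 1983 Thm. 3 at `(n′, n″) = (a, 17)`, `1 ≤ a ≤ 16` — UNCONDITIONAL:** for `φ ≫ φ = -d`,
`finrank_ℚ End⁰(A) = 2`, `1 ≤ n_{i√d}(φ) ≤ 16`, `n_{−i√d}(φ) = 17`, the Hodge classes on every power `A^{N+1}` are
generated by divisor classes (core `UnitarySeventeen.eq_top_of_smul`). [cite: Ribet1983, Thm. 0 and Thm. 3]
[cite: Gordon1997, Thm. 6.3 (3) and Corollary] -/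
theorem AbelianVariety.isDivisorGenerated_powSucc_of_ribetTypeSeventeen (A : AbelianVariety ℂ) (φ : A ⟶ A)
    {d : ℕ} (hd : 0 < d) (hφ : φ ≫ φ = -(d • 𝟙 A)) (hE2 : Module.finrank ℚ A.endAlgebra = 2)
    (ha1 : 1 ≤ eigenMultiplicity A φ (Complex.I * (Real.sqrt d : ℂ)))
    (ha16 : eigenMultiplicity A φ (Complex.I * (Real.sqrt d : ℂ)) ≤ 16)
    (h17 : eigenMultiplicity A φ (-(Complex.I * (Real.sqrt d : ℂ))) = 17) (N : ℕ) :
    IsDivisorGenerated (A.powSucc N) := by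
  refine AbelianVariety.isDivisorGenerated_powSucc_of_ribetType_ofCoreSmul A φ hd hφ hE2 (by omega) (by omega) ?_ N
  intro W' _ _ _ 𝔊 ι P' Q' s hbr hirr hι hιι hP' hQ' hfinP' hfinQ' hadd hsmul hsymm hPQ hdefP hdefQ hadj
  exact UnitarySeventeen.eq_top_of_smul hbr hirr hι hιι hP' hQ' (by rw [hfinP']; exact ha1) (by rw [hfinP']; exact ha16)
    (by rw [hfinQ', h17]) hadd hsmul hsymm hPQ hdefP hdefQ hadj

/-- The mirror: `n_{i√d}(φ) = 17`, `1 ≤ n_{−i√d}(φ) ≤ 16` (core `UnitarySeventeen.eq_top_of_smul'`).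
[cite: Ribet1983, Thm. 0 and Thm. 3] [cite: Gordon1997, Thm. 6.3 (3) and Corollary] -/
theorem AbelianVariety.isDivisorGenerated_powSucc_of_ribetTypeSeventeen' (A : AbelianVariety ℂ) (φ : A ⟶ A)
    {d : ℕ} (hd : 0 < d) (hφ : φ ≫ φ = -(d • 𝟙 A)) (hE2 : Module.finrank ℚ A.endAlgebra = 2)
    (h17 : eigenMultiplicity A φ (Complex.I * (Real.sqrt d : ℂ)) = 17)
    (hb1 : 1 ≤ eigenMultiplicity A φ (-(Complex.I * (Real.sqrt d : ℂ))))
    (hb16 : eigenMultiplicity A φ (-(Complex.I * (Real.sqrt d : ℂ))) ≤ 16) (N : ℕ) :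
    IsDivisorGenerated (A.powSucc N) := by
  refine AbelianVariety.isDivisorGenerated_powSucc_of_ribetType_ofCoreSmul A φ hd hφ hE2 (by omega) (by omega) ?_ N
  intro W' _ _ _ 𝔊 ι P' Q' s hbr hirr hι hιι hP' hQ' hfinP' hfinQ' hadd hsmul hsymm hPQ hdefP hdefQ hadj
  exact UnitarySeventeen.eq_top_of_smul' hbr hirr hι hιι hP' hQ' (by rw [hfinP', h17]) (by rw [hfinQ']; exact hb1)
    (by rw [hfinQ']; exact hb16) hadd hsmul hsymm hPQ hdefP hdefQ hadj

/-- **The Hodge conjecture for all powers `A^{N+1}` of an abelian variety of Ribet type `(a, 17)`, `1 ≤ a ≤ 16` —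
UNCONDITIONAL.** [cite: Ribet1983, Thm. 3] [cite: Deligne2000, §1] -/
theorem hodgeConjectureFor_powSucc_of_ribetTypeSeventeen (A : AbelianVariety ℂ) (φ : A ⟶ A)
    {d : ℕ} (hd : 0 < d) (hφ : φ ≫ φ = -(d • 𝟙 A)) (hE2 : Module.finrank ℚ A.endAlgebra = 2)
    (ha1 : 1 ≤ eigenMultiplicity A φ (Complex.I * (Real.sqrt d : ℂ)))
    (ha16 : eigenMultiplicity A φ (Complex.I * (Real.sqrt d : ℂ)) ≤ 16)
    (h17 : eigenMultiplicity A φ (-(Complex.I * (Real.sqrt d : ℂ))) = 17) (N : ℕ) :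
    HodgeConjectureFor (A.powSucc N).dim (A.powSucc N).X :=
  hodgeConjectureFor_of_isDivisorGenerated _
    (AbelianVariety.isDivisorGenerated_powSucc_of_ribetTypeSeventeen A φ hd hφ hE2 ha1 ha16 h17 N)

/-- **Signature `{a, 17}` in dimension `a + 17`, `1 ≤ a ≤ 16`: `B• = D•` on all powers — UNCONDITIONAL** (either
eigenvalue may carry the `17`). [cite: Ribet1983, Thm. 0 and Thm. 3] [cite: MoonenZarhin1999LowDim, §2 (2.4)] -/
theorem AbelianVariety.isDivisorGenerated_powSucc_of_signature_seventeen (A : AbelianVariety ℂ)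
    (φ : A ⟶ A) {d : ℕ} (hd : 0 < d) (hφ : φ ≫ φ = -(d • 𝟙 A)) (hE2 : Module.finrank ℚ A.endAlgebra = 2)
    (h18 : 18 ≤ A.dim) (h33 : A.dim ≤ 33)
    (h17 : eigenMultiplicity A φ (Complex.I * (Real.sqrt d : ℂ)) = 17 ∨
      eigenMultiplicity A φ (-(Complex.I * (Real.sqrt d : ℂ))) = 17)
    (N : ℕ) : IsDivisorGenerated (A.powSucc N) := by
  have hsum := eigenMultiplicity_add_eigenMultiplicity_neg_eq_dim A φ hd hφ
  rcases h17 with h | h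
  · exact AbelianVariety.isDivisorGenerated_powSucc_of_ribetTypeSeventeen' A φ hd hφ hE2 h (by omega) (by omega) N
  · exact AbelianVariety.isDivisorGenerated_powSucc_of_ribetTypeSeventeen A φ hd hφ hE2 (by omega) (by omega) h N

/-- **29-FOLDS of signature `{12, 17}`: `B• = D•` on all powers — UNCONDITIONAL.**
[cite: Ribet1983, Thm. 0 and Thm. 3] [cite: MoonenZarhin1999LowDim, §2 (2.4)] -/
theorem AbelianVariety.isDivisorGenerated_powSucc_of_twentyninefold_twelveSeventeen (A : AbelianVariety ℂ)
    (φ : A ⟶ A) {d : ℕ} (hd : 0 < d) (hφ : φ ≫ φ = -(d • 𝟙 A)) (hE2 : Module.finrank ℚ A.endAlgebra = 2)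
    (hX : A.dim = 29)
    (h12 : eigenMultiplicity A φ (Complex.I * (Real.sqrt d : ℂ)) = 12 ∨ eigenMultiplicity A φ (-(Complex.I * (Real.sqrt d : ℂ))) = 12)
    (N : ℕ) : IsDivisorGenerated (A.powSucc N) := by
  have hsum := eigenMultiplicity_add_eigenMultiplicity_neg_eq_dim A φ hd hφ
  rw [hX] at hsum
  exact AbelianVariety.isDivisorGenerated_powSucc_of_signature_seventeen A φ hd hφ hE2 (by omega) (by omega)
    (by omega) N

/-- **31-FOLDS of signature `{14, 17}`: `B• = D•` on all powers — UNCONDITIONAL.**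
[cite: Ribet1983, Thm. 0 and Thm. 3] [cite: MoonenZarhin1999LowDim, §2 (2.4)] -/
theorem AbelianVariety.isDivisorGenerated_powSucc_of_thirtyonefold_fourteenSeventeen (A : AbelianVariety ℂ)
    (φ : A ⟶ A) {d : ℕ} (hd : 0 < d) (hφ : φ ≫ φ = -(d • 𝟙 A)) (hE2 : Module.finrank ℚ A.endAlgebra = 2)
    (hX : A.dim = 31)
    (h14 : eigenMultiplicity A φ (Complex.I * (Real.sqrt d : ℂ)) = 14 ∨ eigenMultiplicity A φ (-(Complex.I * (Real.sqrt d : ℂ))) = 14)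
    (N : ℕ) : IsDivisorGenerated (A.powSucc N) := by
  have hsum := eigenMultiplicity_add_eigenMultiplicity_neg_eq_dim A φ hd hφ
  rw [hX] at hsum
  exact AbelianVariety.isDivisorGenerated_powSucc_of_signature_seventeen A φ hd hφ hE2 (by omega) (by omega)
    (by omega) N

/-- **The Hodge conjecture for all powers of a 29-FOLD of signature `{12, 17}` and of a 31-FOLD of signature `{14, 17}` —
UNCONDITIONAL** (one statement: `dim A ∈ {29, 31}` and a multiplicity `17`). [cite: Ribet1983, Thm. 3] [cite: Deligne2000, §1] -/
theorem hodgeConjectureFor_powSucc_of_signature_seventeen (A : AbelianVariety ℂ)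
    (φ : A ⟶ A) {d : ℕ} (hd : 0 < d) (hφ : φ ≫ φ = -(d • 𝟙 A)) (hE2 : Module.finrank ℚ A.endAlgebra = 2)
    (h18 : 18 ≤ A.dim) (h33 : A.dim ≤ 33)
    (h17 : eigenMultiplicity A φ (Complex.I * (Real.sqrt d : ℂ)) = 17 ∨
      eigenMultiplicity A φ (-(Complex.I * (Real.sqrt d : ℂ))) = 17)
    (N : ℕ) : HodgeConjectureFor (A.powSucc N).dim (A.powSucc N).X :=
  hodgeConjectureFor_of_isDivisorGenerated _
    (AbelianVariety.isDivisorGenerated_powSucc_of_signature_seventeen A φ hd hφ hE2 h18 h33 h17 N)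

end Cells

/-! ### §2 Per-`X` census in dimensions `29` and `31` -/

section Census

variable {X : AbelianVariety ℂ}

/-- **`B• = D•` on all powers of a SIMPLE complex abelian `29`-FOLD, granted ONLY `End⁰ = ℚ` and the `k`-signatures
`{8, 21}`, `{9, 20}`, `{10, 19}`, `{14, 15}`** (the cell `{12, 17}` is §1). [cite: MoonenZarhin1999LowDim, §2 (2.4) and Thm. (2.7)]
[cite: Ribet1983, Thms. 0–3] -/
theorem isDivisorGenerated_powSucc_of_isSimple_twentyninefold' (hs : X.IsSimple) (hX : X.dim = 29)
    (h1 : Module.finrank ℚ X.endAlgebra = 1 → ∀ N : ℕ, IsDivisorGenerated (X.powSucc N))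
    (hres : ∀ (φ : X ⟶ X) (d : ℕ), 0 < d → φ ≫ φ = -(d • 𝟙 X) → Module.finrank ℚ X.endAlgebra = 2 →
      (eigenMultiplicity X φ (Complex.I * (Real.sqrt d : ℂ)) = 8 ∨ eigenMultiplicity X φ (Complex.I * (Real.sqrt d : ℂ)) = 9 ∨
        eigenMultiplicity X φ (Complex.I * (Real.sqrt d : ℂ)) = 10 ∨ eigenMultiplicity X φ (Complex.I * (Real.sqrt d : ℂ)) = 14 ∨
        eigenMultiplicity X φ (Complex.I * (Real.sqrt d : ℂ)) = 15 ∨ eigenMultiplicity X φ (Complex.I * (Real.sqrt d : ℂ)) = 19 ∨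
        eigenMultiplicity X φ (Complex.I * (Real.sqrt d : ℂ)) = 20 ∨ eigenMultiplicity X φ (Complex.I * (Real.sqrt d : ℂ)) = 21) →
      ∀ N : ℕ, IsDivisorGenerated (X.powSucc N))
    (N : ℕ) : IsDivisorGenerated (X.powSucc N) := by
  refine isDivisorGenerated_powSucc_of_isSimple_of_prime_of_odd_of_ge_eight_notin hs (by rw [hX]; norm_num)
    (by rw [hX]; exact ⟨14, rfl⟩) h1 (fun φ d hd hφ he2 ha hb h11a h11b h13a h13b N => ?_) N
  have hsum := eigenMultiplicity_add_eigenMultiplicity_neg_eq_dim X φ hd hφ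
  rw [hX] at hsum
  by_cases h17 : eigenMultiplicity X φ (Complex.I * (Real.sqrt d : ℂ)) = 17 ∨
      eigenMultiplicity X φ (-(Complex.I * (Real.sqrt d : ℂ))) = 17
  · exact AbelianVariety.isDivisorGenerated_powSucc_of_signature_seventeen X φ hd hφ he2 (by omega) (by omega) h17 N
  · exact hres φ d hd hφ he2 (by omega) N

/-- **`B• = D•` on all powers of a SIMPLE complex abelian `31`-FOLD, granted ONLY `End⁰ = ℚ` and the `k`-signatures
`{8, 23}`, `{9, 22}`, `{10, 21}`, `{12, 19}`, `{15, 16}`** (the cell `{14, 17}` is §1). [cite: MoonenZarhin1999LowDim, §2 (2.4) and Thm. (2.7)]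
[cite: Ribet1983, Thms. 0–3] -/
theorem isDivisorGenerated_powSucc_of_isSimple_thirtyonefold' (hs : X.IsSimple) (hX : X.dim = 31)
    (h1 : Module.finrank ℚ X.endAlgebra = 1 → ∀ N : ℕ, IsDivisorGenerated (X.powSucc N))
    (hres : ∀ (φ : X ⟶ X) (d : ℕ), 0 < d → φ ≫ φ = -(d • 𝟙 X) → Module.finrank ℚ X.endAlgebra = 2 →
      (eigenMultiplicity X φ (Complex.I * (Real.sqrt d : ℂ)) = 8 ∨ eigenMultiplicity X φ (Complex.I * (Real.sqrt d : ℂ)) = 9 ∨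
        eigenMultiplicity X φ (Complex.I * (Real.sqrt d : ℂ)) = 10 ∨ eigenMultiplicity X φ (Complex.I * (Real.sqrt d : ℂ)) = 12 ∨
        eigenMultiplicity X φ (Complex.I * (Real.sqrt d : ℂ)) = 15 ∨ eigenMultiplicity X φ (Complex.I * (Real.sqrt d : ℂ)) = 16 ∨
        eigenMultiplicity X φ (Complex.I * (Real.sqrt d : ℂ)) = 19 ∨ eigenMultiplicity X φ (Complex.I * (Real.sqrt d : ℂ)) = 21 ∨
        eigenMultiplicity X φ (Complex.I * (Real.sqrt d : ℂ)) = 22 ∨ eigenMultiplicity X φ (Complex.I * (Real.sqrt d : ℂ)) = 23) →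
      ∀ N : ℕ, IsDivisorGenerated (X.powSucc N))
    (N : ℕ) : IsDivisorGenerated (X.powSucc N) := by
  refine isDivisorGenerated_powSucc_of_isSimple_of_prime_of_odd_of_ge_eight_notin hs (by rw [hX]; norm_num)
    (by rw [hX]; exact ⟨15, rfl⟩) h1 (fun φ d hd hφ he2 ha hb h11a h11b h13a h13b N => ?_) N
  have hsum := eigenMultiplicity_add_eigenMultiplicity_neg_eq_dim X φ hd hφ
  rw [hX] at hsum
  by_cases h17 : eigenMultiplicity X φ (Complex.I * (Real.sqrt d : ℂ)) = 17 ∨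
      eigenMultiplicity X φ (-(Complex.I * (Real.sqrt d : ℂ))) = 17
  · exact AbelianVariety.isDivisorGenerated_powSucc_of_signature_seventeen X φ hd hφ he2 (by omega) (by omega) h17 N
  · exact hres φ d hd hφ he2 (by omega) N

end Census

end Literature.AlgebraicGeometry.HodgeTheory

end
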